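import Literature.NumberTheory.Automorphic.UnitaryGroupArchSkew
import Literature.NumberTheory.Automorphic.UnitaryGroupArchTopology
import HarnessLib

/-!
# The Cayley chart of `U(J)(E ⊗ ℝ)` at `1`: `ĉ : 𝔲 → U(J)(E ⊗ ℝ)`, `ĉ X = (1 − X)(1 + X)⁻¹`, a homeomorphism of
# `{X ∈ 𝔲 | 1 ± X invertible}` onto the open neighbourhood `{g | 1 + g invertible}` of `1`, with inverse `g ↦ c(g)` —
# a chart WITHOUT any manifold structure, for EVERY form `J`
(Weyl, *The Classical Groups* (1939), Ch. II §10; Knapp, *Lie Groups Beyond an Introduction* (2002), I §1, I §10.)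

Topic `NumberTheory/Automorphic`; namespace `Literature.NumberTheory.Automorphic.UnitaryGroup`.  Definitions with bodies
(`cayleySource`, `cayleyChart`, `cayleyInv`) and proved theorems: no named fact, no instance, no notation, no `sorry`.  Cell
`hodgecm-mathlib`, F0∕P3 road «DM∞» (archimedean Dixmier–Malliavin, weak form, for `U(H)(L⁺ ⊗ ℝ)`; census
`F0/P3/p03/CENSUS-DMinf.F0P3p03g8.md`), brick B5a, chart part (over ★ `Analysis/Calculus/CayleyTransform` and ★
`UnitaryGroupArchSkew`); the companion B5b (`UnitaryGroupArchCayleyHaar`) puts Haar measure of `U(J)(E ⊗ ℝ)` in these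
coordinates, and the road's B6 compares them with the coordinates of the second kind `s ↦ Π exp(s_i X_i)`.

SETTING: as in ★ `UnitaryGroupArchSkew` (`𝔲 = archSkew F E c N J ≤ M_N(E ⊗ ℝ)`, `U(J)(E ⊗ ℝ) = arch F E c N J ≤ GL_N(E ⊗ ℝ)`,
`E` a number field, scoped operator norm on `M_N(E ⊗ ℝ)`).

CONTENT (§4).
* `cayleySource F E c N J = {X : ↥𝔲 | IsUnit (1 + X) ∧ IsUnit (1 − X)}` (open, `∋ 0`);
* **`cayleyChart F E c N J : ↥𝔲 → ↥(U(J)(E ⊗ ℝ))`** — `c(X)` as a unit on the source (★ `cayley_mem_arch`), junk `1` off it;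
  `coe_cayleyChart`, `cayleyChart_zero : ĉ 0 = 1`, `isUnit_one_add_coe_cayleyChart`, `cayley_coe_cayleyChart : c(ĉ X) = X`,
  **`injOn_cayleyChart`**, `continuousAt_arch_iff` (continuity into `U(J) ≤ GL` is read on matrices), **`continuousOn_cayleyChart`**;
* the inverse chart **`cayleyInv F E c N J : ↥(U(J)(E ⊗ ℝ)) → ↥𝔲`** (`c(g)` when `1 + g` is invertible, ★ `cayley_coe_mem_archSkew`),
  `cayleyChart_cayleyInv`, `cayleyInv_cayleyChart`, **`cayleyChart_image_cayleySource : ĉ '' source = {g | IsUnit (1 + g)}`**,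
  `isOpen_setOf_isUnit_one_add_coe`, `one_mem_setOf_isUnit_one_add_coe`, `continuousOn_cayleyInv`, `image_cayleyChart_eq`,
  **`isOpen_image_cayleyChart`** (images of open subsets of the source are open: `ĉ` is a homeomorphism onto its open image),
  `isOpen_cayleySource_inter_preimage`;
* the packaging **`cayleyPartialHomeomorph F E c N J : OpenPartialHomeomorph ↥𝔲 ↥(U(J)(E ⊗ ℝ))`** (source∕target∕`toFun`∕`invFun`
  as above; `coe_…`, `…_symm`, `…_source`, `…_target`) — the shape the road's B6 consumes.

HONEST SCOPE.  Point-set topology over the two companions; no manifold, no measure.  HC_CM is proved only modulo the printed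
citations until rung 0 closes; this file discharges no printed statement (banked currency for the road's B5b∕B6∕B7).

## References
* H. Weyl, *The Classical Groups, their Invariants and Representations*, Princeton (1939), Ch. II §10. [Weyl1939]
* A. W. Knapp, *Lie Groups Beyond an Introduction*, 2nd ed., Birkhäuser (2002), I §1, I §10. [Knapp2002]
-/

set_option autoImplicit false

noncomputable section

open NumberField NumberField.mixedEmbedding Set Filter Topology Literature.Analysis.Calculus
-- `Classical`: the place subtypes indexing `mixedSpace E` are `Fintype` classically (`NormedCommRing (mixedSpace E)`);
-- `Matrix.Norms.Operator`: the scoped `L∞`-operator normed algebra structure on `M_N(E ⊗ ℝ)` (as for ★ `IsArchSmooth`).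
open scoped Classical Matrix Matrix.Norms.Operator MatrixGroups

namespace Literature.NumberTheory.Automorphic

namespace UnitaryGroup

section Chart

variable (F E : Type) [Field F] [Field E] [NumberField E] [Algebra F E] (c : E ≃ₐ[F] E) (N : ℕ) (J : Matrix (Fin N) (Fin N) E)

variable {F E c N}

/-! ## §4 The Cayley chart `ĉ : 𝔲 → U(J)(E ⊗ ℝ)` as a map of subtypes -/

variable (F E c N) in
/-- The SOURCE of the Cayley chart: `{X ∈ 𝔲 | 1 + X and 1 − X invertible}`. [cite: Weyl1939, Ch. II §10] -/
def cayleySource : Set (archSkew F E c N J) :=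
  {X | IsUnit (1 + (X : Matrix (Fin N) (Fin N) (mixedSpace E))) ∧ IsUnit (1 - (X : Matrix (Fin N) (Fin N) (mixedSpace E)))}

omit [NumberField E] in
/-- Membership in the source. [cite: Weyl1939, Ch. II §10] -/
theorem mem_cayleySource_iff (X : archSkew F E c N J) :
    X ∈ cayleySource F E c N J ↔
      IsUnit (1 + (X : Matrix (Fin N) (Fin N) (mixedSpace E))) ∧ IsUnit (1 - (X : Matrix (Fin N) (Fin N) (mixedSpace E))) :=
  Iff.rfl

omit [NumberField E] in
/-- `0` is in the source. [cite: Weyl1939, Ch. II §10] -/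
theorem zero_mem_cayleySource : (0 : archSkew F E c N J) ∈ cayleySource F E c N J := by
  rw [mem_cayleySource_iff, Submodule.coe_zero, add_zero, sub_zero]; exact ⟨isUnit_one, isUnit_one⟩

/-- The source is open in `𝔲`. [cite: Weyl1939, Ch. II §10] -/
theorem isOpen_cayleySource : IsOpen (cayleySource F E c N J) :=
  (isOpen_setOf_isUnit_one_add.preimage continuous_subtype_val).inter (isOpen_setOf_isUnit_one_sub.preimage continuous_subtype_val)

variable (F E c N) in
/-- **THE CAYLEY CHART** `ĉ : 𝔲 → U(J)(E ⊗ ℝ)`: `ĉ X = c(X)` on the source, junk `1` off it. [cite: Weyl1939, Ch. II §10] -/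
def cayleyChart (X : archSkew F E c N J) : arch F E c N J :=
  if h : IsUnit (1 + (X : Matrix (Fin N) (Fin N) (mixedSpace E))) ∧ IsUnit (1 - (X : Matrix (Fin N) (Fin N) (mixedSpace E))) then
    ⟨(isUnit_cayley h.1 h.2).unit, cayley_mem_arch J X.2 h.1 h.2⟩
  else 1

omit [NumberField E] in
/-- On the source, `ĉ X` is `c(X)` as a matrix. [cite: Weyl1939, Ch. II §10] -/
theorem coe_cayleyChart {X : archSkew F E c N J} (h : X ∈ cayleySource F E c N J) :
    ((cayleyChart F E c N J X : GL (Fin N) (mixedSpace E)) : Matrix (Fin N) (Fin N) (mixedSpace E)) =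
      cayley (X : Matrix (Fin N) (Fin N) (mixedSpace E)) := by
  rw [cayleyChart, dif_pos ((mem_cayleySource_iff J X).1 h)]
  exact IsUnit.unit_spec _

omit [NumberField E] in
/-- Off the source, `ĉ X = 1`. [cite: Weyl1939, Ch. II §10] -/
theorem cayleyChart_of_not_mem {X : archSkew F E c N J} (h : X ∉ cayleySource F E c N J) : cayleyChart F E c N J X = 1 := by
  rw [cayleyChart, dif_neg (fun h' => h ((mem_cayleySource_iff J X).2 h'))]

omit [NumberField E] in
/-- `ĉ 0 = 1`. [cite: Weyl1939, Ch. II §10] -/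
@[simp] theorem cayleyChart_zero : cayleyChart F E c N J 0 = 1 := by
  refine Subtype.ext (Units.ext ?_)
  rw [coe_cayleyChart J (zero_mem_cayleySource J), Submodule.coe_zero, cayley_zero]
  rfl

omit [NumberField E] in
/-- For `X` in the source, `1 + ĉ X` is invertible. [cite: Weyl1939, Ch. II §10] -/
theorem isUnit_one_add_coe_cayleyChart {X : archSkew F E c N J} (h : X ∈ cayleySource F E c N J) :
    IsUnit (1 + ((cayleyChart F E c N J X : GL (Fin N) (mixedSpace E)) : Matrix (Fin N) (Fin N) (mixedSpace E))) := by
  rw [coe_cayleyChart J h]; exact isUnit_one_add_cayley h.1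

omit [NumberField E] in
/-- **The inverse of the chart**: `c(ĉ X) = X` on the source. [cite: Weyl1939, Ch. II §10] -/
theorem cayley_coe_cayleyChart {X : archSkew F E c N J} (h : X ∈ cayleySource F E c N J) :
    cayley ((cayleyChart F E c N J X : GL (Fin N) (mixedSpace E)) : Matrix (Fin N) (Fin N) (mixedSpace E)) =
      (X : Matrix (Fin N) (Fin N) (mixedSpace E)) := by
  rw [coe_cayleyChart J h, cayley_cayley h.1]

omit [NumberField E] in
/-- The chart is injective on its source. [cite: Weyl1939, Ch. II §10] -/
theorem injOn_cayleyChart : Set.InjOn (cayleyChart F E c N J) (cayleySource F E c N J) := by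
  intro X hX Y hY e
  apply Subtype.ext
  rw [← cayley_coe_cayleyChart J hX, ← cayley_coe_cayleyChart J hY, e]

/-- Continuity into `U(J)(E ⊗ ℝ) ≤ GL_N(E ⊗ ℝ)` is read on matrices (`Units.val` is an open embedding of the units of
a complete normed ring). [cite: Knapp2002, I §1] -/
theorem continuousAt_arch_iff {α : Type*} [TopologicalSpace α] (f : α → arch F E c N J) (x : α) :
    ContinuousAt f x ↔
      ContinuousAt (fun y => ((f y : GL (Fin N) (mixedSpace E)) : Matrix (Fin N) (Fin N) (mixedSpace E))) x := by
  have hind : Topology.IsInducing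
      (fun g : arch F E c N J => ((g : GL (Fin N) (mixedSpace E)) : Matrix (Fin N) (Fin N) (mixedSpace E))) :=
    (Units.isOpenEmbedding_val (R := Matrix (Fin N) (Fin N) (mixedSpace E))).isInducing.comp Topology.IsInducing.subtypeVal
  exact hind.continuousAt_iff

/-- The chart is continuous at every point of its source. [cite: Weyl1939, Ch. II §10] -/
theorem continuousAt_cayleyChart {X : archSkew F E c N J} (h : X ∈ cayleySource F E c N J) :
    ContinuousAt (cayleyChart F E c N J) X := by
  rw [continuousAt_arch_iff]
  have hev : (fun Y : archSkew F E c N J =>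
      ((cayleyChart F E c N J Y : GL (Fin N) (mixedSpace E)) : Matrix (Fin N) (Fin N) (mixedSpace E))) =ᶠ[𝓝 X]
      fun Y => cayley (Y : Matrix (Fin N) (Fin N) (mixedSpace E)) := by
    filter_upwards [(isOpen_cayleySource J).mem_nhds h] with Y hY
    exact coe_cayleyChart J hY
  refine ContinuousAt.congr_of_eventuallyEq ?_ hev
  exact (continuousAt_cayley h.1).comp continuous_subtype_val.continuousAt

/-- The chart is continuous on its source. [cite: Weyl1939, Ch. II §10] -/
theorem continuousOn_cayleyChart : ContinuousOn (cayleyChart F E c N J) (cayleySource F E c N J) :=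
  fun _ hX => (continuousAt_cayleyChart J hX).continuousWithinAt

variable (F E c N) in
/-- The INVERSE CHART `U(J)(E ⊗ ℝ) → 𝔲`: `g ↦ c(g)` when `1 + g` is invertible (junk `0` off that set).
[cite: Weyl1939, Ch. II §10] -/
def cayleyInv (g : arch F E c N J) : archSkew F E c N J :=
  if h : IsUnit (1 + ((g : GL (Fin N) (mixedSpace E)) : Matrix (Fin N) (Fin N) (mixedSpace E))) then
    ⟨cayley ((g : GL (Fin N) (mixedSpace E)) : Matrix (Fin N) (Fin N) (mixedSpace E)), cayley_coe_mem_archSkew J g.2 h⟩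
  else 0

omit [NumberField E] in
/-- `cayleyInv g = c(g)` as a matrix when `1 + g` is invertible. [cite: Weyl1939, Ch. II §10] -/
theorem coe_cayleyInv {g : arch F E c N J} (h : IsUnit (1 + ((g : GL (Fin N) (mixedSpace E)) : Matrix (Fin N) (Fin N) (mixedSpace E)))) :
    (cayleyInv F E c N J g : Matrix (Fin N) (Fin N) (mixedSpace E)) = cayley ((g : GL (Fin N) (mixedSpace E)) : Matrix (Fin N) (Fin N) (mixedSpace E)) := by
  rw [cayleyInv, dif_pos h]

omit [NumberField E] in
/-- `cayleyInv g` lies in the source when `1 + g` is invertible. [cite: Weyl1939, Ch. II §10] -/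
theorem cayleyInv_mem_cayleySource {g : arch F E c N J}
    (h : IsUnit (1 + ((g : GL (Fin N) (mixedSpace E)) : Matrix (Fin N) (Fin N) (mixedSpace E)))) :
    cayleyInv F E c N J g ∈ cayleySource F E c N J := by
  rw [mem_cayleySource_iff, coe_cayleyInv J h]
  exact ⟨isUnit_one_add_cayley h, isUnit_one_sub_cayley_coe _ h⟩

omit [NumberField E] in
/-- **`ĉ (cayleyInv g) = g`** when `1 + g` is invertible. [cite: Weyl1939, Ch. II §10] -/
theorem cayleyChart_cayleyInv {g : arch F E c N J}
    (h : IsUnit (1 + ((g : GL (Fin N) (mixedSpace E)) : Matrix (Fin N) (Fin N) (mixedSpace E)))) :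
    cayleyChart F E c N J (cayleyInv F E c N J g) = g := by
  refine Subtype.ext (Units.ext ?_)
  rw [coe_cayleyChart J (cayleyInv_mem_cayleySource J h), coe_cayleyInv J h, cayley_cayley h]

omit [NumberField E] in
/-- **`cayleyInv (ĉ X) = X`** on the source. [cite: Weyl1939, Ch. II §10] -/
theorem cayleyInv_cayleyChart {X : archSkew F E c N J} (h : X ∈ cayleySource F E c N J) :
    cayleyInv F E c N J (cayleyChart F E c N J X) = X := by
  apply Subtype.ext
  rw [coe_cayleyInv J (isUnit_one_add_coe_cayleyChart J h), cayley_coe_cayleyChart J h]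

omit [NumberField E] in
/-- **THE IMAGE OF THE CHART is `{g | 1 + g invertible}`.** [cite: Weyl1939, Ch. II §10] -/
theorem cayleyChart_image_cayleySource :
    cayleyChart F E c N J '' cayleySource F E c N J =
      {g : arch F E c N J | IsUnit (1 + ((g : GL (Fin N) (mixedSpace E)) : Matrix (Fin N) (Fin N) (mixedSpace E)))} := by
  ext g
  constructor
  · rintro ⟨X, hX, rfl⟩
    exact isUnit_one_add_coe_cayleyChart J hX
  · intro hg
    exact ⟨cayleyInv F E c N J g, cayleyInv_mem_cayleySource J hg, cayleyChart_cayleyInv J hg⟩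

/-- The image `{g | 1 + g invertible}` is open in `U(J)(E ⊗ ℝ)`. [cite: Weyl1939, Ch. II §10] -/
theorem isOpen_setOf_isUnit_one_add_coe :
    IsOpen {g : arch F E c N J | IsUnit (1 + ((g : GL (Fin N) (mixedSpace E)) : Matrix (Fin N) (Fin N) (mixedSpace E)))} :=
  isOpen_setOf_isUnit_one_add.preimage (Units.continuous_val.comp continuous_subtype_val)

omit [NumberField E] in
/-- `1` lies in the image. [cite: Weyl1939, Ch. II §10] -/
theorem one_mem_setOf_isUnit_one_add_coe :
    (1 : arch F E c N J) ∈ {g : arch F E c N J | IsUnit (1 + ((g : GL (Fin N) (mixedSpace E)) : Matrix (Fin N) (Fin N) (mixedSpace E)))} := by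
  simp only [Set.mem_setOf_eq, OneMemClass.coe_one, Units.val_one]
  rw [one_add_one_eq_two]; exact isUnit_two

/-- The inverse chart is continuous at every `g` with `1 + g` invertible. [cite: Weyl1939, Ch. II §10] -/
theorem continuousAt_cayleyInv {g : arch F E c N J}
    (h : IsUnit (1 + ((g : GL (Fin N) (mixedSpace E)) : Matrix (Fin N) (Fin N) (mixedSpace E)))) :
    ContinuousAt (cayleyInv F E c N J) g := by
  rw [Topology.IsInducing.subtypeVal.continuousAt_iff]
  have hev : (Subtype.val ∘ cayleyInv F E c N J) =ᶠ[𝓝 g]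
      fun k => cayley (((k : arch F E c N J) : GL (Fin N) (mixedSpace E)) : Matrix (Fin N) (Fin N) (mixedSpace E)) := by
    filter_upwards [(isOpen_setOf_isUnit_one_add_coe J).mem_nhds h] with k hk
    exact coe_cayleyInv J hk
  refine ContinuousAt.congr_of_eventuallyEq ?_ hev
  exact ContinuousAt.comp (f := fun k : arch F E c N J => ((k : GL (Fin N) (mixedSpace E)) : Matrix (Fin N) (Fin N) (mixedSpace E)))
    (x := g) (continuousAt_cayley h) (Units.continuous_val.comp continuous_subtype_val).continuousAt

/-- The inverse chart is continuous on `{g | 1 + g invertible}`. [cite: Weyl1939, Ch. II §10] -/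
theorem continuousOn_cayleyInv :
    ContinuousOn (cayleyInv F E c N J)
      {g : arch F E c N J | IsUnit (1 + ((g : GL (Fin N) (mixedSpace E)) : Matrix (Fin N) (Fin N) (mixedSpace E)))} :=
  fun _ hg => (continuousAt_cayleyInv J hg).continuousWithinAt

omit [NumberField E] in
/-- **Images of open subsets of the source are open in `U(J)(E ⊗ ℝ)`** (the chart is a homeomorphism onto its open image):
`ĉ '' S = {g | 1 + g invertible} ∩ cayleyInv⁻¹' S`. [cite: Weyl1939, Ch. II §10] -/
theorem image_cayleyChart_eq {S : Set (archSkew F E c N J)} (hS : S ⊆ cayleySource F E c N J) :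
    cayleyChart F E c N J '' S =
      {g : arch F E c N J | IsUnit (1 + ((g : GL (Fin N) (mixedSpace E)) : Matrix (Fin N) (Fin N) (mixedSpace E)))} ∩
        cayleyInv F E c N J ⁻¹' S := by
  ext g
  constructor
  · rintro ⟨X, hX, rfl⟩
    exact ⟨isUnit_one_add_coe_cayleyChart J (hS hX), by rw [Set.mem_preimage, cayleyInv_cayleyChart J (hS hX)]; exact hX⟩
  · rintro ⟨hg, hgS⟩
    exact ⟨cayleyInv F E c N J g, hgS, cayleyChart_cayleyInv J hg⟩

/-- Images of open subsets of the source are open. [cite: Weyl1939, Ch. II §10] -/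
theorem isOpen_image_cayleyChart {S : Set (archSkew F E c N J)} (hS : S ⊆ cayleySource F E c N J) (hSo : IsOpen S) :
    IsOpen (cayleyChart F E c N J '' S) := by
  rw [image_cayleyChart_eq J hS]
  exact (continuousOn_cayleyInv J).isOpen_inter_preimage (isOpen_setOf_isUnit_one_add_coe J) hSo

/-- Preimages of open sets of `U(J)(E ⊗ ℝ)` meet the source in open sets. [cite: Weyl1939, Ch. II §10] -/
theorem isOpen_cayleySource_inter_preimage {T : Set (arch F E c N J)} (hT : IsOpen T) :
    IsOpen (cayleySource F E c N J ∩ cayleyChart F E c N J ⁻¹' T) :=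
  (continuousOn_cayleyChart J).isOpen_inter_preimage (isOpen_cayleySource J) hT

variable (F E c N) in
/-- **THE CAYLEY CHART AS AN OPEN PARTIAL HOMEOMORPHISM** `𝔲 ⇀ U(J)(E ⊗ ℝ)` (Mathlib's `OpenPartialHomeomorph`): source
`cayleySource` (`1 ± X` invertible), target `{g | 1 + g invertible}` (an open neighbourhood of `1`), `toFun = cayleyChart`,
`invFun = cayleyInv` — the shape in which the road's B6 consumes the chart. [cite: Weyl1939, Ch. II §10] -/
def cayleyPartialHomeomorph : OpenPartialHomeomorph (archSkew F E c N J) (arch F E c N J) where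
  toFun := cayleyChart F E c N J
  invFun := cayleyInv F E c N J
  source := cayleySource F E c N J
  target := {g : arch F E c N J | IsUnit (1 + ((g : GL (Fin N) (mixedSpace E)) : Matrix (Fin N) (Fin N) (mixedSpace E)))}
  map_source' := fun _ hX => isUnit_one_add_coe_cayleyChart J hX
  map_target' := fun _ hg => cayleyInv_mem_cayleySource J hg
  left_inv' := fun _ hX => cayleyInv_cayleyChart J hX
  right_inv' := fun _ hg => cayleyChart_cayleyInv J hg
  open_source := isOpen_cayleySource J
  open_target := isOpen_setOf_isUnit_one_add_coe J
  continuousOn_toFun := continuousOn_cayleyChart J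
  continuousOn_invFun := continuousOn_cayleyInv J

/-- `cayleyPartialHomeomorph` is `cayleyChart` as a function. [cite: Weyl1939, Ch. II §10] -/
@[simp] theorem coe_cayleyPartialHomeomorph : ⇑(cayleyPartialHomeomorph F E c N J) = cayleyChart F E c N J := rfl

/-- The inverse of `cayleyPartialHomeomorph` is `cayleyInv` as a function. [cite: Weyl1939, Ch. II §10] -/
@[simp] theorem coe_cayleyPartialHomeomorph_symm : ⇑(cayleyPartialHomeomorph F E c N J).symm = cayleyInv F E c N J := rfl

/-- The source of `cayleyPartialHomeomorph`. [cite: Weyl1939, Ch. II §10] -/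
@[simp] theorem cayleyPartialHomeomorph_source : (cayleyPartialHomeomorph F E c N J).source = cayleySource F E c N J := rfl

/-- The target of `cayleyPartialHomeomorph`. [cite: Weyl1939, Ch. II §10] -/
@[simp] theorem cayleyPartialHomeomorph_target :
    (cayleyPartialHomeomorph F E c N J).target =
      {g : arch F E c N J | IsUnit (1 + ((g : GL (Fin N) (mixedSpace E)) : Matrix (Fin N) (Fin N) (mixedSpace E)))} := rfl

/-- `0 ∈ source` and `ĉ 0 = 1`: the chart is centred at the identity. [cite: Weyl1939, Ch. II §10] -/
theorem zero_mem_cayleyPartialHomeomorph_source : (0 : archSkew F E c N J) ∈ (cayleyPartialHomeomorph F E c N J).source :=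
  zero_mem_cayleySource J

end Chart

end UnitaryGroup

end Literature.NumberTheory.Automorphic
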